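import Summits.NavierStokesRegularity.NavierStokesRegularity.Theses.TypeILiouville
import Summits.NavierStokesRegularity.NavierStokesRegularity.Theorems.TypeICertificateLadderRungZero
import Literature.Analysis.FluidPDE.NSCriticalClosureBesovBounded
import Literature.Analysis.FluidPDE.TaoLocalisationHolds
import Literature.Analysis.FluidPDE.KNSSTypeII

/-!
# `TypeIliouvilleNoTypeII` (stmt-NavierStokesRegularity-0056): the exponent `1/2` is tight, and the harmless strengthenings

Tightness (boundary) lemmas for the crux `TypeILiouville.TypeIliouvilleNoTypeII` ("every
finite-energy blow-up from a rapidly decaying datum is Type I: `‖u(t, x)‖ ≤ C/√(T − t)` eventually"),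
extracted from the crux work file `Cruxes/TypeIliouvilleNoTypeII/Disproof.lean` (cdisprove seat,
cycle 1).  Consider the one-parameter family of statements "rate `(T − t)^{-α}`": same hypotheses,
conclusion `∃ C, ∀ᶠ t ↑ T, ∀ x, ‖u t x‖ ≤ C / (T − t) ^ α`.

* `noBlowupRate_mono`: the family is monotone in `α` (smaller exponent = stronger statement).
* `typeIliouvilleNoTypeII_iff_noBlowupRate_half`: `α = 1/2` is the crux (`x ^ (1/2) = √x`).
* `noBlowup_of_noBlowupRate_lt_half` / `noBlowupRate_of_noBlowup`: for `α < 1/2` the statement is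
  EQUIVALENT to "no finite-energy blow-up from Schwartz data at all" (no maximal smooth Leray–Hopf
  solution with finite lifespan exists) — by the tree's `typeICertificateLadder_rungZero` (Leray's
  lower rate `‖u(t)‖_∞ ≥ c√ν/√(T − t)`, Leray 1934 §19 (3.9)).  So `1/2` is the least exponent at
  which the crux is not already Clay (A) for blow-up times: a rate-improving proof strategy proves
  regularity outright.
* `forall_Ico_of_typeIliouvilleNoTypeII`: the crux already gives the Type-I bound on ALL of `[0, T)`
  (slab bounds `exists_forall_norm_le_of_tao2011` + `IsTypeIBlowup.exists_sqrt_mul_norm_le`), so the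
  "all times" strengthening is harmless.
[cite: Leray1934, §19 (3.8)–(3.9) p. 224]
-/

noncomputable section

namespace Summit.NavierStokesRegularity.NavierStokesRegularity.Theorems.TypeIliouvilleNoTypeIINegative

open Set Filter Topology Function MeasureTheory
open Literature.Analysis.FluidPDE
open Summit.NavierStokesRegularity.NavierStokesRegularity.Theses

/-- **The rate family is monotone in the exponent**: for `α ≤ β`, the rate-`α` statement implies
the rate-`β` statement (near `T` one has `T − t ≤ 1`, so `(T − t)^{-α} ≤ (T − t)^{-β}`; a valid
constant is `≥ 0`). [folklore] -/
theorem noBlowupRate_mono {α β : ℝ} (hαβ : α ≤ β)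
    (h : ∀ (ν T : ℝ), 0 < ν → 0 < T → ∀ (u : ℝ → EuclideanSpace ℝ (Fin 3) → EuclideanSpace ℝ (Fin 3))
      (p : ℝ → EuclideanSpace ℝ (Fin 3) → ℝ),
      IsMaximalSmoothSolution ν 0 u p T → IsLerayHopfOn T ν 0 (u 0) u → HasRapidSpatialDecay (u 0) →
      ∃ C : ℝ, ∀ᶠ t in 𝓝[<] T, ∀ x, ‖u t x‖ ≤ C / (T - t) ^ α) :
    ∀ (ν T : ℝ), 0 < ν → 0 < T → ∀ (u : ℝ → EuclideanSpace ℝ (Fin 3) → EuclideanSpace ℝ (Fin 3))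
      (p : ℝ → EuclideanSpace ℝ (Fin 3) → ℝ),
      IsMaximalSmoothSolution ν 0 u p T → IsLerayHopfOn T ν 0 (u 0) u → HasRapidSpatialDecay (u 0) →
      ∃ C : ℝ, ∀ᶠ t in 𝓝[<] T, ∀ x, ‖u t x‖ ≤ C / (T - t) ^ β := by
  intro ν T hν hT u p hmax hLH hdec
  obtain ⟨C, hC⟩ := h ν T hν hT u p hmax hLH hdec
  refine ⟨C, ?_⟩
  have h1 : ∀ᶠ t in 𝓝[<] T, t ∈ Ioo (T - 1) T := Ioo_mem_nhdsLT (by linarith)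
  filter_upwards [hC, h1] with t ht ht1 x
  have hTt : 0 < T - t := sub_pos.2 ht1.2
  have hTt1 : T - t ≤ 1 := by linarith [ht1.1]
  have hC0 : 0 ≤ C := by
    have := (norm_nonneg _).trans (ht x)
    exact (div_nonneg_iff.1 this).elim (fun h => h.1) fun h =>
      absurd h.2 (not_le.2 (Real.rpow_pos_of_pos hTt α))
  calc ‖u t x‖ ≤ C / (T - t) ^ α := ht x
    _ ≤ C / (T - t) ^ β := by
        apply div_le_div_of_nonneg_left hC0 (Real.rpow_pos_of_pos hTt β)
        exact Real.rpow_le_rpow_of_exponent_ge hTt hTt1 hαβ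

/-- **`α = 1/2` is the crux**: `TypeIliouvilleNoTypeII` is the rate-`1/2` statement
(`(T − t) ^ (1/2) = √(T − t)`, Mathlib `Real.sqrt_eq_rpow`). [folklore] -/
theorem typeIliouvilleNoTypeII_iff_noBlowupRate_half :
    TypeILiouville.TypeIliouvilleNoTypeII ↔
    ∀ (ν T : ℝ), 0 < ν → 0 < T → ∀ (u : ℝ → EuclideanSpace ℝ (Fin 3) → EuclideanSpace ℝ (Fin 3))
      (p : ℝ → EuclideanSpace ℝ (Fin 3) → ℝ),
      IsMaximalSmoothSolution ν 0 u p T → IsLerayHopfOn T ν 0 (u 0) u → HasRapidSpatialDecay (u 0) →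
      ∃ C : ℝ, ∀ᶠ t in 𝓝[<] T, ∀ x, ‖u t x‖ ≤ C / (T - t) ^ (1 / 2 : ℝ) := by
  have key : ∀ (T t : ℝ), (T - t) ^ (1 / 2 : ℝ) = Real.sqrt (T - t) := fun T t =>
    (Real.sqrt_eq_rpow (T - t)).symm
  simp only [TypeILiouville.TypeIliouvilleNoTypeII, IsTypeIBlowup, key]

/-- **Below `1/2` the rate statement is "no blow-up".**  For `α < 1/2`, the rate-`α` statement
implies that NO maximal smooth solution with finite lifespan is Leray–Hopf from a rapidly decaying
datum: the rate makes `√(T − t)‖u(t, x)‖ ≤ |C| (T − t)^{1/2 − α}` eventually smaller than the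
universal `C₀ √ν` of `typeICertificateLadder_rungZero` (Leray 1934, §19 (3.9); proved in the tree),
so `u` extends past `T`, contradicting maximality. [cite: Leray1934, §19 (3.8)–(3.9) p. 224] -/
theorem noBlowup_of_noBlowupRate_lt_half {α : ℝ} (hα : α < 1 / 2)
    (h : ∀ (ν T : ℝ), 0 < ν → 0 < T → ∀ (u : ℝ → EuclideanSpace ℝ (Fin 3) → EuclideanSpace ℝ (Fin 3))
      (p : ℝ → EuclideanSpace ℝ (Fin 3) → ℝ),
      IsMaximalSmoothSolution ν 0 u p T → IsLerayHopfOn T ν 0 (u 0) u → HasRapidSpatialDecay (u 0) →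
      ∃ C : ℝ, ∀ᶠ t in 𝓝[<] T, ∀ x, ‖u t x‖ ≤ C / (T - t) ^ α) :
    ∀ (ν T : ℝ), 0 < ν → 0 < T → ∀ (u : ℝ → EuclideanSpace ℝ (Fin 3) → EuclideanSpace ℝ (Fin 3))
      (p : ℝ → EuclideanSpace ℝ (Fin 3) → ℝ),
      IsLerayHopfOn T ν 0 (u 0) u → HasRapidSpatialDecay (u 0) → ¬ IsMaximalSmoothSolution ν 0 u p T := by
  intro ν T hν hT u p hLH hdec hmax
  obtain ⟨C, hC⟩ := h ν T hν hT u p hmax hLH hdec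
  obtain ⟨C₀, hC₀, hrung⟩ := typeICertificateLadder_rungZero
  apply hmax.2
  apply hrung ν T hν hT u p hmax.1 hLH hdec
  -- eventually `√(T - t) ‖u t x‖ ≤ |C| (T - t)^{1/2 - α} < C₀ √ν`
  have hexp : 0 < 1 / 2 - α := by linarith
  have hlim : Tendsto (fun t : ℝ => |C| * (T - t) ^ (1 / 2 - α)) (𝓝[<] T) (𝓝 0) := by
    have h1 : Tendsto (fun t : ℝ => T - t) (𝓝[<] T) (𝓝[>] 0) := by
      refine tendsto_nhdsWithin_iff.2 ⟨?_, ?_⟩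
      · have : Tendsto (fun t : ℝ => T - t) (𝓝 T) (𝓝 (T - T)) :=
          (continuous_const.sub continuous_id).tendsto T
        simpa using this.mono_left nhdsWithin_le_nhds
      · filter_upwards [self_mem_nhdsWithin] with t ht
        exact sub_pos.2 (show t < T from ht)
    have h2 : Tendsto (fun s : ℝ => s ^ (1 / 2 - α)) (𝓝[>] 0) (𝓝 0) := by
      have hc : Tendsto (fun s : ℝ => s ^ (1 / 2 - α)) (𝓝 0) (𝓝 ((0 : ℝ) ^ (1 / 2 - α))) :=
        (Real.continuous_rpow_const hexp.le).tendsto 0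
      rw [Real.zero_rpow hexp.ne'] at hc
      exact hc.mono_left nhdsWithin_le_nhds
    simpa using (h2.comp h1).const_mul |C|
  have hpos : 0 < C₀ * Real.sqrt ν := mul_pos hC₀ (Real.sqrt_pos.2 hν)
  have h3 : ∀ᶠ t in 𝓝[<] T, |C| * (T - t) ^ (1 / 2 - α) < C₀ * Real.sqrt ν :=
    hlim.eventually (gt_mem_nhds hpos)
  filter_upwards [hC, h3, self_mem_nhdsWithin] with t ht ht3 htT x
  have hTt : 0 < T - t := sub_pos.2 htT
  have hr : 0 < (T - t) ^ α := Real.rpow_pos_of_pos hTt α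
  have h4 : Real.sqrt (T - t) * ‖u t x‖ ≤ |C| * (T - t) ^ (1 / 2 - α) := by
    calc Real.sqrt (T - t) * ‖u t x‖ ≤ Real.sqrt (T - t) * (|C| / (T - t) ^ α) := by
          refine mul_le_mul_of_nonneg_left ((ht x).trans ?_) (Real.sqrt_nonneg _)
          exact div_le_div_of_nonneg_right (le_abs_self C) hr.le
      _ = |C| * (T - t) ^ (1 / 2 - α) := by
          rw [Real.sqrt_eq_rpow, Real.rpow_sub hTt, mul_div_assoc', mul_comm, mul_div_assoc]
  exact h4.trans ht3.le

/-- The converse is vacuity: with no finite-energy blow-up, every rate statement holds (no maximal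
solution satisfies the hypotheses).  Together with `noBlowup_of_noBlowupRate_lt_half`: for
`α < 1/2` the rate-`α` statement is exactly "no blow-up". [folklore] -/
theorem noBlowupRate_of_noBlowup (α : ℝ)
    (h : ∀ (ν T : ℝ), 0 < ν → 0 < T → ∀ (u : ℝ → EuclideanSpace ℝ (Fin 3) → EuclideanSpace ℝ (Fin 3))
      (p : ℝ → EuclideanSpace ℝ (Fin 3) → ℝ),
      IsLerayHopfOn T ν 0 (u 0) u → HasRapidSpatialDecay (u 0) → ¬ IsMaximalSmoothSolution ν 0 u p T) :
    ∀ (ν T : ℝ), 0 < ν → 0 < T → ∀ (u : ℝ → EuclideanSpace ℝ (Fin 3) → EuclideanSpace ℝ (Fin 3))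
      (p : ℝ → EuclideanSpace ℝ (Fin 3) → ℝ),
      IsMaximalSmoothSolution ν 0 u p T → IsLerayHopfOn T ν 0 (u 0) u → HasRapidSpatialDecay (u 0) →
      ∃ C : ℝ, ∀ᶠ t in 𝓝[<] T, ∀ x, ‖u t x‖ ≤ C / (T - t) ^ α :=
  fun ν T hν hT u p hmax hLH hdec => absurd hmax (h ν T hν hT u p hLH hdec)

/-- **The "all times" strengthening is harmless**: the crux already yields the Type-I bound on ALL
of `[0, T)`, because a classical Leray–Hopf solution from a rapidly decaying datum is bounded on
closed sub-slabs (`exists_forall_norm_le_of_tao2011`, Tao 2013 Cor. 11.1, fed with the discharged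
`tao2011_hasBoundedSobolevNormsOn_holds`) and an eventual rate plus slab bounds give a rate on
`[0, T)` (`IsTypeIBlowup.exists_sqrt_mul_norm_le`). [cite: Tao2011, Cor. 11.1 + Cor. 4.3 + Thm. 5.4 (iv)] -/
theorem forall_Ico_of_typeIliouvilleNoTypeII (h : TypeILiouville.TypeIliouvilleNoTypeII) :
    ∀ (ν T : ℝ), 0 < ν → 0 < T → ∀ (u : ℝ → EuclideanSpace ℝ (Fin 3) → EuclideanSpace ℝ (Fin 3))
      (p : ℝ → EuclideanSpace ℝ (Fin 3) → ℝ),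
      IsMaximalSmoothSolution ν 0 u p T → IsLerayHopfOn T ν 0 (u 0) u → HasRapidSpatialDecay (u 0) →
      ∃ C : ℝ, ∀ t ∈ Ico 0 T, ∀ x, ‖u t x‖ ≤ C / Real.sqrt (T - t) := by
  intro ν T hν hT u p hmax hLH hdec
  have hI := h ν T hν hT u p hmax hLH hdec
  have hslab := exists_forall_norm_le_of_tao2011 tao2011_hasBoundedSobolevNormsOn_holds hν hmax.1
    hLH hdec
  have hslab' : ∀ T₁ < T, ∃ M : ℝ, ∀ t ∈ Icc 0 T₁, ∀ x, ‖u t x‖ ≤ M := by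
    intro T₁ hT₁
    obtain ⟨M, hM⟩ := hslab (max T₁ (T / 2)) ⟨lt_max_of_lt_right (by linarith),
      max_lt hT₁ (by linarith)⟩
    exact ⟨M, fun t ht x => hM t ⟨ht.1, ht.2.trans (le_max_left _ _)⟩ x⟩
  obtain ⟨C, hC⟩ := hI.exists_sqrt_mul_norm_le hslab'
  refine ⟨C, fun t ht x => ?_⟩
  have hsq : 0 < Real.sqrt (T - t) := Real.sqrt_pos.2 (sub_pos.2 ht.2)
  rw [le_div_iff₀ hsq, mul_comm]
  exact hC t ht x

end Summit.NavierStokesRegularity.NavierStokesRegularity.Theorems.TypeIliouvilleNoTypeIINegative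

end
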